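import Summits.Ventures.HodgeRepro.Tier3LemmaRWeilLine

/-!
# The diagonal operators `⋀ⁿ(A′ b)`, `b ∈ K^ι`, on the wedge basis: eigenvalues, separation of the `σ`-lines,
and the indicator of the `σ`-lines in the `K`-span of the eigenvalue vectors

Blind re-derivation cell `pub-hodge-repro`, seat `t3-p4` (Tier 3, T3.5 for T3.4 = Lemma R).  Target tree path
`lean/Summits/Ventures/HodgeRepro/Tier3DiagonalCharacters.lean`; imports the cell's `Tier3LemmaRWeilLine` (hence
`Tier3LemmaRAbstract`, `Tier3WeilProjector` and everything below them).

WHAT THIS FILE STATES (towards LEMMA-R-RESIDUE.md (S2), §3–§4(c): «`K ⊗ ℂ = ⊕_χ K_χ` … the coordinate idempotent `e_χ`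
acting as the projector onto `K_χ` … the projector onto `⊕_σ K_{(σ,…,σ)}` is the action of a `ℚ`-RATIONAL element
of `R = F^{⊗ 2p}`»).  On the data `V_B` with `K`-basis `ω′ : ι → V_B` (`H¹(B, ℚ)`), the diagonal action `A′ b`
(`ω′_i ↦ b_i • ω′_i`, `b ∈ K^ι`: the CM structure of the corners, `(ι_1(b_1), …, ι_{2p}(b_{2p}))^*` on `H¹`) and the
eigenbasis `e′` of `K ⊗ V_B` with its wedge basis:

* `map_baseChange_diag_ιMulti_family` — `⋀ⁿ(1 ⊗ A′ b)` is DIAGONAL in the wedge basis: the wedge of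
  `L = {(i₁, x₁) < ⋯ < (iₙ, xₙ)}` is an eigenvector with eigenvalue `χ_L(b) = ∏_j x_j(b_{i_j})` (the character of
  the monoid `K^ι` attached to `L` — LEMMA-R-RESIDUE.md §4(a): «`a_1 ⊗ ⋯ ⊗ a_{2p}` acts on `K_χ` by `∏_i χ_i(a_i)`»);
* `exists_char_ne_of_ne_lineSet` — the `σ`-line `L_σ = {(i, σ) : i ∈ ι}` is SEPARATED from every other `2p`-set `L`
  by some `b`: `χ_L(b) ≠ χ_{L_σ}(b)` (`b = (1, …, 0, …, 1)` if `L` misses a corner, `b = (1, …, c, …, 1)` with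
  `x(c) ≠ σ(c)` if `L` has the pair `(i, x)`, `x ≠ σ`, at that corner);
* `single_lineSet_mem_span_char`, `indicator_lineSet_mem_span_char` — the indicator of `L_σ`, and hence of the set of
  all `σ`-lines, lies in the `K`-span of the eigenvalue vectors `L ↦ χ_L(b)`, `b ∈ K^ι` (the span is closed under
  pointwise products since `χ_L(b b′) = χ_L(b) χ_L(b′)`, so `∏_{L ≠ L_σ} (χ_·(b_L) − χ_L(b_L))` is a multiple of
  the indicator).

HONESTY.  Finite linear algebra on the cell's own modules; no definition is introduced (`χ_L(b)` is written out as
`∏ j, (enum L j).2 (b (enum L j).1)`, `enum L = Set.powersetCard.ofFinEmbEquiv.symm L`); nothing geometric is built.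
The next file turns these into «the rational projector `e₀` onto the Weil line is a `ℚ`-combination of the operators
`⋀ⁿ(A′ b)`» (descent from `K`- to `F₀`-coefficients by a trace average).  HC_CM is NOT proved by anyone in this repository.
-/

set_option autoImplicit false

open TensorProduct Finset

namespace HodgeRepro.Tier3

open HodgeRepro.RouteC HodgeRepro.CMHodgeOn

/-! ### §1 The eigenvalue of a diagonal operator on a coordinate wedge -/
section Eigen

variable {F₀ K : Type*} [Field F₀] [Field K] [Algebra F₀ K]
variable {VB : Type*} [AddCommGroup VB] [Module K VB] [Module F₀ VB] [IsScalarTower F₀ K VB]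
variable {ι : Type*} [Fintype ι] [DecidableEq ι] [DecidableEq (K ≃ₐ[F₀] K)]

omit [Fintype ι] [DecidableEq ι] [DecidableEq (K ≃ₐ[F₀] K)] in
/-- **`⋀ⁿ(1 ⊗ A′ b)` is diagonal in the wedge basis**: for the diagonal action `A′` of `K^ι` on `V_B`
(`(1 ⊗ A′ b) e′ (i, x) = x (b i) • e′ (i, x)`) and any `n`-set `L`, the wedge `e′_{L₁} ∧ ⋯ ∧ e′_{Lₙ}` is an eigenvector
of `⋀ⁿ(1 ⊗ A′ b)` with eigenvalue `χ_L(b) = ∏_j x_j(b_{i_j})`, `L = {(i₁, x₁) < ⋯ < (iₙ, xₙ)}`. -/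
theorem map_baseChange_diag_ιMulti_family [LinearOrder (ι × (K ≃ₐ[F₀] K))]
    (A' : (ι → K) → VB →ₗ[K] VB) (e' : Module.Basis (ι × (K ≃ₐ[F₀] K)) K (K ⊗[F₀] VB))
    (he2' : ∀ (x : K ≃ₐ[F₀] K) (i : ι) (b : ι → K),
      LinearMap.lTensor K ((A' b).restrictScalars F₀) (e' (i, x)) = x (b i) • e' (i, x))
    (n : ℕ) (b : ι → K) (L : Set.powersetCard (ι × (K ≃ₐ[F₀] K)) n) :
    exteriorPower.map n (LinearMap.baseChange K ((A' b).restrictScalars F₀))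
        (exteriorPower.ιMulti_family K n e' L) =
      (∏ j : Fin n, (Set.powersetCard.ofFinEmbEquiv.symm L j).2 (b (Set.powersetCard.ofFinEmbEquiv.symm L j).1)) •
        exteriorPower.ιMulti_family K n e' L := by
  have hfac : ∀ j : Fin n, LinearMap.baseChange K ((A' b).restrictScalars F₀)
      (e' (Set.powersetCard.ofFinEmbEquiv.symm L j)) =
      (Set.powersetCard.ofFinEmbEquiv.symm L j).2 (b (Set.powersetCard.ofFinEmbEquiv.symm L j).1) •
        e' (Set.powersetCard.ofFinEmbEquiv.symm L j) := by
    intro j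
    rw [LinearMap.baseChange_eq_ltensor]
    exact he2' _ _ b
  rw [exteriorPower.ιMulti_family, exteriorPower.map_apply_ιMulti]
  have hcomp : LinearMap.baseChange K ((A' b).restrictScalars F₀) ∘ (e' ∘ Set.powersetCard.ofFinEmbEquiv.symm L) =
      fun j => (Set.powersetCard.ofFinEmbEquiv.symm L j).2 (b (Set.powersetCard.ofFinEmbEquiv.symm L j).1) •
        (e' ∘ Set.powersetCard.ofFinEmbEquiv.symm L) j := by
    funext j
    exact hfac j
  rw [hcomp, AlternatingMap.map_smul_univ]

end Eigen

/-! ### §2 The characters `χ_L` separate the `σ`-lines from every other set -/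
section Separate

variable {F₀ K : Type*} [Field F₀] [Field K] [Algebra F₀ K]
variable {ι : Type*} [Fintype ι] [DecidableEq ι] [DecidableEq (K ≃ₐ[F₀] K)]

omit [Fintype ι] [DecidableEq ι] [DecidableEq (K ≃ₐ[F₀] K)] in
/-- `χ_L` is multiplicative in `b`. -/
theorem char_mul [LinearOrder (ι × (K ≃ₐ[F₀] K))] (n : ℕ) (L : Set.powersetCard (ι × (K ≃ₐ[F₀] K)) n)
    (b b' : ι → K) :
    (∏ j : Fin n, (Set.powersetCard.ofFinEmbEquiv.symm L j).2
        ((b * b') (Set.powersetCard.ofFinEmbEquiv.symm L j).1)) =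
      (∏ j : Fin n, (Set.powersetCard.ofFinEmbEquiv.symm L j).2 (b (Set.powersetCard.ofFinEmbEquiv.symm L j).1)) *
        ∏ j : Fin n, (Set.powersetCard.ofFinEmbEquiv.symm L j).2 (b' (Set.powersetCard.ofFinEmbEquiv.symm L j).1) := by
  rw [← Finset.prod_mul_distrib]
  refine Finset.prod_congr rfl fun j _ => ?_
  rw [Pi.mul_apply, map_mul]

omit [Fintype ι] [DecidableEq ι] [DecidableEq (K ≃ₐ[F₀] K)] in
/-- `χ_L(1) = 1`. -/
theorem char_one [LinearOrder (ι × (K ≃ₐ[F₀] K))] (n : ℕ) (L : Set.powersetCard (ι × (K ≃ₐ[F₀] K)) n) :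
    (∏ j : Fin n, (Set.powersetCard.ofFinEmbEquiv.symm L j).2
        ((1 : ι → K) (Set.powersetCard.ofFinEmbEquiv.symm L j).1)) = 1 := by
  refine Finset.prod_eq_one fun j _ => ?_
  rw [Pi.one_apply, map_one]

omit [Fintype ι] [DecidableEq (K ≃ₐ[F₀] K)] in
/-- On `b = (1, …, c, …, 1)` (`c` at the corner `i₁`), `χ_L(b)` is the product of `x(c)` over the pairs `(i₁, x) ∈ L`
at that corner — when `L` has exactly one such pair `(i₁, x)` (the `j₀`-th of its enumeration), `χ_L(b) = x(c)`. -/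
theorem char_update_eq_of_unique [LinearOrder (ι × (K ≃ₐ[F₀] K))] (n : ℕ)
    (L : Set.powersetCard (ι × (K ≃ₐ[F₀] K)) n) (i₁ : ι) (c : K) (j₀ : Fin n)
    (hj₀ : (Set.powersetCard.ofFinEmbEquiv.symm L j₀).1 = i₁)
    (huniq : ∀ j, (Set.powersetCard.ofFinEmbEquiv.symm L j).1 = i₁ → j = j₀) :
    (∏ j : Fin n, (Set.powersetCard.ofFinEmbEquiv.symm L j).2
        (Function.update (fun _ => (1 : K)) i₁ c (Set.powersetCard.ofFinEmbEquiv.symm L j).1)) =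
      (Set.powersetCard.ofFinEmbEquiv.symm L j₀).2 c := by
  rw [Finset.prod_eq_single j₀]
  · rw [hj₀, Function.update_self]
  · intro j _ hj
    have hne : (Set.powersetCard.ofFinEmbEquiv.symm L j).1 ≠ i₁ := fun h => hj (huniq j h)
    rw [Function.update_of_ne hne, map_one]
  · intro h
    exact absurd (Finset.mem_univ j₀) h

omit [Fintype ι] [DecidableEq (K ≃ₐ[F₀] K)] in
/-- On `b = (1, …, c, …, 1)` (`c` at the corner `i₁`), `χ_L(b) = 1` when no pair of `L` sits at the corner `i₁`. -/
theorem char_update_eq_one_of_forall_ne [LinearOrder (ι × (K ≃ₐ[F₀] K))] (n : ℕ)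
    (L : Set.powersetCard (ι × (K ≃ₐ[F₀] K)) n) (i₁ : ι) (c : K)
    (h : ∀ j, (Set.powersetCard.ofFinEmbEquiv.symm L j).1 ≠ i₁) :
    (∏ j : Fin n, (Set.powersetCard.ofFinEmbEquiv.symm L j).2
        (Function.update (fun _ => (1 : K)) i₁ c (Set.powersetCard.ofFinEmbEquiv.symm L j).1)) = 1 := by
  refine Finset.prod_eq_one fun j _ => ?_
  rw [Function.update_of_ne (h j), map_one]

/-- **The `σ`-line is separated from every other `n`-set** (`n = |ι|`): for `L ≠ L_σ` there is `b ∈ K^ι` with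
`χ_L(b) ≠ χ_{L_σ}(b)`.  If `L` misses some corner `i₁`, take `b = (1, …, 0, …, 1)` (`0` at `i₁`): `χ_L(b) = 1`,
`χ_{L_σ}(b) = σ(0) = 0`.  Otherwise `L` has exactly one pair `(i, x_i)` per corner (`|L| = |ι|`) and some
`x_{i₁} ≠ σ`, so some `c` has `x_{i₁}(c) ≠ σ(c)`: take `b = (1, …, c, …, 1)`. -/
theorem exists_char_ne_of_ne_lineSet [LinearOrder (ι × (K ≃ₐ[F₀] K))] {n : ℕ} (hn : Fintype.card ι = n)
    (σ : K ≃ₐ[F₀] K) (L₀ L : Set.powersetCard (ι × (K ≃ₐ[F₀] K)) n)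
    (hL₀ : (L₀ : Finset (ι × (K ≃ₐ[F₀] K))) = lineSet σ) (hne : L ≠ L₀) :
    ∃ b : ι → K,
      (∏ j : Fin n, (Set.powersetCard.ofFinEmbEquiv.symm L j).2 (b (Set.powersetCard.ofFinEmbEquiv.symm L j).1)) ≠
        ∏ j : Fin n, (Set.powersetCard.ofFinEmbEquiv.symm L₀ j).2 (b (Set.powersetCard.ofFinEmbEquiv.symm L₀ j).1) := by
  classical
  -- the enumerations
  set t : Fin n → ι × (K ≃ₐ[F₀] K) := ⇑(Set.powersetCard.ofFinEmbEquiv.symm L) with ht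
  set t₀ : Fin n → ι × (K ≃ₐ[F₀] K) := ⇑(Set.powersetCard.ofFinEmbEquiv.symm L₀) with ht₀
  have ht₀inj : Function.Injective t₀ := (Set.powersetCard.ofFinEmbEquiv.symm L₀).injective
  have ht₀2 : ∀ j, (t₀ j).2 = σ := by
    intro j
    have hmem : t₀ j ∈ (L₀ : Finset (ι × (K ≃ₐ[F₀] K))) :=
      (Set.powersetCard.mem_range_ofFinEmbEquiv_symm_iff_mem L₀ (t₀ j)).mp ⟨j, rfl⟩
    rw [hL₀] at hmem
    exact mem_lineSet.mp hmem
  have ht₀finj : Function.Injective fun j => (t₀ j).1 := by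
    intro j j' h
    apply ht₀inj
    exact Prod.ext h ((ht₀2 j).trans (ht₀2 j').symm)
  have ht₀fbij : Function.Bijective fun j => (t₀ j).1 :=
    (Fintype.bijective_iff_injective_and_card _).mpr ⟨ht₀finj, by rw [Fintype.card_fin, hn]⟩
  -- `χ_{L₀}((1, …, c, …, 1)) = σ(c)`
  have hchar₀ : ∀ (i₁ : ι) (c : K),
      (∏ j : Fin n, (t₀ j).2 (Function.update (fun _ => (1 : K)) i₁ c (t₀ j).1)) = σ c := by
    intro i₁ c
    obtain ⟨j₀, hj₀⟩ := ht₀fbij.surjective i₁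
    rw [char_update_eq_of_unique n L₀ i₁ c j₀ hj₀ (fun j hj => ht₀finj (hj.trans hj₀.symm)), ht₀2]
  by_cases hmiss : ∃ i₁ : ι, ∀ j, (t j).1 ≠ i₁
  · -- `L` misses the corner `i₁`
    obtain ⟨i₁, hi₁⟩ := hmiss
    refine ⟨Function.update (fun _ => (1 : K)) i₁ 0, ?_⟩
    rw [char_update_eq_one_of_forall_ne n L i₁ 0 hi₁, hchar₀ i₁ 0, map_zero]
    exact one_ne_zero
  · -- `L` meets every corner, hence exactly once; some pair `(i₁, x)` has `x ≠ σ`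
    simp only [not_exists, not_forall, not_not] at hmiss
    have hfsurj : Function.Surjective fun j => (t j).1 := fun i₁ => hmiss i₁
    have hfbij : Function.Bijective fun j => (t j).1 :=
      (Fintype.bijective_iff_surjective_and_card _).mpr ⟨hfsurj, by rw [Fintype.card_fin, hn]⟩
    have hex : ∃ j, (t j).2 ≠ σ := by
      by_contra hall
      simp only [not_exists, not_not] at hall
      apply hne
      refine Subtype.ext (Finset.ext fun p => ?_)
      rw [hL₀, mem_lineSet, Set.powersetCard.mem_coe_iff,
        ← Set.powersetCard.mem_range_ofFinEmbEquiv_symm_iff_mem, Set.mem_range]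
      constructor
      · rintro ⟨j, rfl⟩
        exact hall j
      · intro hp
        obtain ⟨j, hj⟩ := hfbij.surjective p.1
        refine ⟨j, Prod.ext hj ?_⟩
        rw [hall j, hp]
    obtain ⟨j₁, hj₁⟩ := hex
    obtain ⟨c, hc⟩ : ∃ c : K, (t j₁).2 c ≠ σ c := by
      by_contra hall
      simp only [not_exists, not_not] at hall
      exact hj₁ (AlgEquiv.ext hall)
    refine ⟨Function.update (fun _ => (1 : K)) (t j₁).1 c, ?_⟩
    rw [char_update_eq_of_unique n L (t j₁).1 c j₁ rfl (fun j hj => hfbij.injective hj), hchar₀]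
    exact hc

end Separate

/-! ### §3 The indicator of the `σ`-lines lies in the `K`-span of the eigenvalue vectors -/
section Span

variable {F₀ K : Type*} [Field F₀] [Field K] [Algebra F₀ K]
variable {ι : Type*} [Fintype ι] [DecidableEq ι] [DecidableEq (K ≃ₐ[F₀] K)]
variable [FiniteDimensional F₀ K] [IsGalois F₀ K]

omit [Fintype ι] [DecidableEq ι] [DecidableEq (K ≃ₐ[F₀] K)] [FiniteDimensional F₀ K] [IsGalois F₀ K] in
/-- The `K`-span of the eigenvalue vectors `v_b = (L ↦ χ_L(b))` is closed under multiplication by `v_{b′} − c`. -/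
theorem mul_sub_mem_span_char [LinearOrder (ι × (K ≃ₐ[F₀] K))] (n : ℕ)
    {f : Set.powersetCard (ι × (K ≃ₐ[F₀] K)) n → K}
    (hf : f ∈ Submodule.span K (Set.range fun b : ι → K => fun L : Set.powersetCard (ι × (K ≃ₐ[F₀] K)) n =>
      ∏ j : Fin n, (Set.powersetCard.ofFinEmbEquiv.symm L j).2 (b (Set.powersetCard.ofFinEmbEquiv.symm L j).1)))
    (b' : ι → K) (c : K) :
    (fun L : Set.powersetCard (ι × (K ≃ₐ[F₀] K)) n =>
      ((∏ j : Fin n, (Set.powersetCard.ofFinEmbEquiv.symm L j).2 (b' (Set.powersetCard.ofFinEmbEquiv.symm L j).1)) - c)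
        * f L) ∈
      Submodule.span K (Set.range fun b : ι → K => fun L : Set.powersetCard (ι × (K ≃ₐ[F₀] K)) n =>
        ∏ j : Fin n, (Set.powersetCard.ofFinEmbEquiv.symm L j).2 (b (Set.powersetCard.ofFinEmbEquiv.symm L j).1)) := by
  -- `(v_{b′} − c) * f = v_{b′} * f − c • f`, and `v_{b′} * ·` preserves the span (`v_{b′} * v_b = v_{b′ b}`)
  have hmul : (fun L : Set.powersetCard (ι × (K ≃ₐ[F₀] K)) n =>
      (∏ j : Fin n, (Set.powersetCard.ofFinEmbEquiv.symm L j).2 (b' (Set.powersetCard.ofFinEmbEquiv.symm L j).1))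
        * f L) ∈
      Submodule.span K (Set.range fun b : ι → K => fun L : Set.powersetCard (ι × (K ≃ₐ[F₀] K)) n =>
        ∏ j : Fin n, (Set.powersetCard.ofFinEmbEquiv.symm L j).2 (b (Set.powersetCard.ofFinEmbEquiv.symm L j).1)) := by
    refine Submodule.span_induction ?_ ?_ ?_ ?_ hf
    · rintro _ ⟨b, rfl⟩
      refine Submodule.subset_span ⟨b' * b, ?_⟩
      funext L
      exact char_mul n L b' b
    · have : (fun L : Set.powersetCard (ι × (K ≃ₐ[F₀] K)) n =>
          (∏ j : Fin n, (Set.powersetCard.ofFinEmbEquiv.symm L j).2 (b' (Set.powersetCard.ofFinEmbEquiv.symm L j).1))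
            * (0 : Set.powersetCard (ι × (K ≃ₐ[F₀] K)) n → K) L) = 0 := by
        funext L
        simp
      rw [this]
      exact Submodule.zero_mem _
    · intro x y _ _ hx hy
      have : (fun L : Set.powersetCard (ι × (K ≃ₐ[F₀] K)) n =>
          (∏ j : Fin n, (Set.powersetCard.ofFinEmbEquiv.symm L j).2 (b' (Set.powersetCard.ofFinEmbEquiv.symm L j).1))
            * (x + y) L) =
          (fun L => (∏ j : Fin n, (Set.powersetCard.ofFinEmbEquiv.symm L j).2
            (b' (Set.powersetCard.ofFinEmbEquiv.symm L j).1)) * x L) +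
          fun L => (∏ j : Fin n, (Set.powersetCard.ofFinEmbEquiv.symm L j).2
            (b' (Set.powersetCard.ofFinEmbEquiv.symm L j).1)) * y L := by
        funext L
        simp [mul_add]
      rw [this]
      exact Submodule.add_mem _ hx hy
    · intro a x _ hx
      have : (fun L : Set.powersetCard (ι × (K ≃ₐ[F₀] K)) n =>
          (∏ j : Fin n, (Set.powersetCard.ofFinEmbEquiv.symm L j).2 (b' (Set.powersetCard.ofFinEmbEquiv.symm L j).1))
            * (a • x) L) =
          a • fun L => (∏ j : Fin n, (Set.powersetCard.ofFinEmbEquiv.symm L j).2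
            (b' (Set.powersetCard.ofFinEmbEquiv.symm L j).1)) * x L := by
        funext L
        simp [mul_left_comm]
      rw [this]
      exact Submodule.smul_mem _ _ hx
  have : (fun L : Set.powersetCard (ι × (K ≃ₐ[F₀] K)) n =>
      ((∏ j : Fin n, (Set.powersetCard.ofFinEmbEquiv.symm L j).2 (b' (Set.powersetCard.ofFinEmbEquiv.symm L j).1)) - c)
        * f L) =
      (fun L => (∏ j : Fin n, (Set.powersetCard.ofFinEmbEquiv.symm L j).2
        (b' (Set.powersetCard.ofFinEmbEquiv.symm L j).1)) * f L) - c • f := by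
    funext L
    simp [sub_mul]
  rw [this]
  exact Submodule.sub_mem _ hmul (Submodule.smul_mem _ _ hf)

omit [Fintype ι] [DecidableEq ι] [DecidableEq (K ≃ₐ[F₀] K)] [FiniteDimensional F₀ K] [IsGalois F₀ K] in
/-- The constant function `1 = v_1` lies in the span. -/
theorem one_mem_span_char [LinearOrder (ι × (K ≃ₐ[F₀] K))] (n : ℕ) :
    (1 : Set.powersetCard (ι × (K ≃ₐ[F₀] K)) n → K) ∈
      Submodule.span K (Set.range fun b : ι → K => fun L : Set.powersetCard (ι × (K ≃ₐ[F₀] K)) n =>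
        ∏ j : Fin n, (Set.powersetCard.ofFinEmbEquiv.symm L j).2 (b (Set.powersetCard.ofFinEmbEquiv.symm L j).1)) := by
  refine Submodule.subset_span ⟨1, ?_⟩
  funext L
  exact char_one n L

omit [IsGalois F₀ K] in
/-- **The indicator of a `σ`-line lies in the `K`-span of the eigenvalue vectors** (`n = |ι|`): with `b_L` a
separating element for each `L ≠ L_σ` (`exists_char_ne_of_ne_lineSet`), the product
`g = ∏_{L ≠ L_σ} (v_{b_L} − χ_L(b_L))` lies in the span, vanishes at every `L ≠ L_σ` and not at `L_σ`, so the
indicator is `g(L_σ)⁻¹ • g`. -/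
theorem single_lineSet_mem_span_char [LinearOrder (ι × (K ≃ₐ[F₀] K))] {n : ℕ} (hn : Fintype.card ι = n)
    (σ : K ≃ₐ[F₀] K) (L₀ : Set.powersetCard (ι × (K ≃ₐ[F₀] K)) n)
    (hL₀ : (L₀ : Finset (ι × (K ≃ₐ[F₀] K))) = lineSet σ) :
    Pi.single L₀ (1 : K) ∈
      Submodule.span K (Set.range fun b : ι → K => fun L : Set.powersetCard (ι × (K ≃ₐ[F₀] K)) n =>
        ∏ j : Fin n, (Set.powersetCard.ofFinEmbEquiv.symm L j).2 (b (Set.powersetCard.ofFinEmbEquiv.symm L j).1)) := by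
  classical
  -- a separating element for every `L ≠ L₀`
  have hsep : ∀ L : Set.powersetCard (ι × (K ≃ₐ[F₀] K)) n, L ≠ L₀ → ∃ b : ι → K,
      (∏ j : Fin n, (Set.powersetCard.ofFinEmbEquiv.symm L j).2 (b (Set.powersetCard.ofFinEmbEquiv.symm L j).1)) ≠
        ∏ j : Fin n, (Set.powersetCard.ofFinEmbEquiv.symm L₀ j).2 (b (Set.powersetCard.ofFinEmbEquiv.symm L₀ j).1) :=
    fun L hL => exists_char_ne_of_ne_lineSet hn σ L₀ L hL₀ hL
  choose! bsep hbsep using hsep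
  -- the product `g`
  set g : Set.powersetCard (ι × (K ≃ₐ[F₀] K)) n → K := fun L' =>
    ∏ L ∈ Finset.univ.erase L₀,
      ((∏ j : Fin n, (Set.powersetCard.ofFinEmbEquiv.symm L' j).2 (bsep L (Set.powersetCard.ofFinEmbEquiv.symm L' j).1))
        - ∏ j : Fin n, (Set.powersetCard.ofFinEmbEquiv.symm L j).2 (bsep L (Set.powersetCard.ofFinEmbEquiv.symm L j).1))
    with hgdef
  have hgmem : g ∈ Submodule.span K (Set.range fun b : ι → K => fun L : Set.powersetCard (ι × (K ≃ₐ[F₀] K)) n =>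
      ∏ j : Fin n, (Set.powersetCard.ofFinEmbEquiv.symm L j).2 (b (Set.powersetCard.ofFinEmbEquiv.symm L j).1)) := by
    -- induction on the finset of factors
    have key : ∀ s : Finset (Set.powersetCard (ι × (K ≃ₐ[F₀] K)) n),
        (fun L' : Set.powersetCard (ι × (K ≃ₐ[F₀] K)) n => ∏ L ∈ s,
          ((∏ j : Fin n, (Set.powersetCard.ofFinEmbEquiv.symm L' j).2
              (bsep L (Set.powersetCard.ofFinEmbEquiv.symm L' j).1))
            - ∏ j : Fin n, (Set.powersetCard.ofFinEmbEquiv.symm L j).2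
              (bsep L (Set.powersetCard.ofFinEmbEquiv.symm L j).1))) ∈
        Submodule.span K (Set.range fun b : ι → K => fun L : Set.powersetCard (ι × (K ≃ₐ[F₀] K)) n =>
          ∏ j : Fin n, (Set.powersetCard.ofFinEmbEquiv.symm L j).2 (b (Set.powersetCard.ofFinEmbEquiv.symm L j).1)) := by
      intro s
      induction s using Finset.induction_on with
      | empty =>
        simp only [Finset.prod_empty]
        exact one_mem_span_char n
      | insert L s hLs ih =>
        have : (fun L' : Set.powersetCard (ι × (K ≃ₐ[F₀] K)) n => ∏ L'' ∈ insert L s,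
            ((∏ j : Fin n, (Set.powersetCard.ofFinEmbEquiv.symm L' j).2
                (bsep L'' (Set.powersetCard.ofFinEmbEquiv.symm L' j).1))
              - ∏ j : Fin n, (Set.powersetCard.ofFinEmbEquiv.symm L'' j).2
                (bsep L'' (Set.powersetCard.ofFinEmbEquiv.symm L'' j).1))) =
            fun L' : Set.powersetCard (ι × (K ≃ₐ[F₀] K)) n =>
              ((∏ j : Fin n, (Set.powersetCard.ofFinEmbEquiv.symm L' j).2
                (bsep L (Set.powersetCard.ofFinEmbEquiv.symm L' j).1))
              - ∏ j : Fin n, (Set.powersetCard.ofFinEmbEquiv.symm L j).2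
                (bsep L (Set.powersetCard.ofFinEmbEquiv.symm L j).1)) *
              ∏ L'' ∈ s, ((∏ j : Fin n, (Set.powersetCard.ofFinEmbEquiv.symm L' j).2
                (bsep L'' (Set.powersetCard.ofFinEmbEquiv.symm L' j).1))
              - ∏ j : Fin n, (Set.powersetCard.ofFinEmbEquiv.symm L'' j).2
                (bsep L'' (Set.powersetCard.ofFinEmbEquiv.symm L'' j).1)) := by
          funext L'
          rw [Finset.prod_insert hLs]
        rw [this]
        exact mul_sub_mem_span_char n ih (bsep L) _
    exact key _
  -- `g` vanishes off `L₀` and not at `L₀`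
  have hg0 : ∀ L', L' ≠ L₀ → g L' = 0 := by
    intro L' hL'
    rw [hgdef]
    exact Finset.prod_eq_zero (Finset.mem_erase.mpr ⟨hL', Finset.mem_univ _⟩) (sub_self _)
  have hg1 : g L₀ ≠ 0 := by
    rw [hgdef]
    simp only
    rw [Finset.prod_ne_zero_iff]
    intro L hL
    rw [Finset.mem_erase] at hL
    exact sub_ne_zero.mpr (hbsep L hL.1).symm
  -- the indicator is `g(L₀)⁻¹ • g`
  have : Pi.single L₀ (1 : K) = (g L₀)⁻¹ • g := by
    funext L'
    by_cases h : L' = L₀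
    · subst h
      rw [Pi.single_eq_same, Pi.smul_apply, smul_eq_mul, inv_mul_cancel₀ hg1]
    · rw [Pi.single_eq_of_ne h, Pi.smul_apply, hg0 L' h, smul_zero]
  rw [this]
  exact Submodule.smul_mem _ _ hgmem

omit [IsGalois F₀ K] in
/-- **The indicator of the set of all `σ`-lines lies in the `K`-span of the eigenvalue vectors** (`n = |ι|`): for
`U : Gal(K/F₀) → (n-sets)` injective with `U σ = L_σ`, the indicator of `P = {U σ : σ}` is `Σ_σ 1_{U σ}`. -/
theorem indicator_lineSet_mem_span_char [LinearOrder (ι × (K ≃ₐ[F₀] K))] {n : ℕ} (hn : Fintype.card ι = n)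
    (U : (K ≃ₐ[F₀] K) → Set.powersetCard (ι × (K ≃ₐ[F₀] K)) n)
    (hU : ∀ σ, (U σ : Finset (ι × (K ≃ₐ[F₀] K))) = lineSet σ) (hUinj : Function.Injective U) :
    (fun L : Set.powersetCard (ι × (K ≃ₐ[F₀] K)) n => if L ∈ Finset.univ.image U then (1 : K) else 0) ∈
      Submodule.span K (Set.range fun b : ι → K => fun L : Set.powersetCard (ι × (K ≃ₐ[F₀] K)) n =>
        ∏ j : Fin n, (Set.powersetCard.ofFinEmbEquiv.symm L j).2 (b (Set.powersetCard.ofFinEmbEquiv.symm L j).1)) := by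
  classical
  have heq : (fun L : Set.powersetCard (ι × (K ≃ₐ[F₀] K)) n => if L ∈ Finset.univ.image U then (1 : K) else 0) =
      ∑ σ, Pi.single (U σ) (1 : K) := by
    funext L
    simp only [Finset.sum_apply, Pi.single_apply]
    by_cases hL : L ∈ Finset.univ.image U
    · obtain ⟨τ, -, rfl⟩ := Finset.mem_image.mp hL
      rw [if_pos hL, Finset.sum_eq_single τ]
      · rw [if_pos rfl]
      · intro σ _ hσ
        rw [if_neg (fun h => hσ (hUinj h.symm))]
      · intro h
        exact absurd (Finset.mem_univ τ) h
    · rw [if_neg hL]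
      refine (Finset.sum_eq_zero fun σ _ => ?_).symm
      refine if_neg fun h => hL ?_
      rw [h]
      exact Finset.mem_image_of_mem U (Finset.mem_univ σ)
  rw [heq]
  exact Submodule.sum_mem _ fun σ _ => single_lineSet_mem_span_char hn σ (U σ) (hU σ)

end Span

end HodgeRepro.Tier3
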